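/-
Copyright (c) 2026. All rights reserved.
Released under Apache 2.0 license as described in the file LICENSE.
Authors: abc-iut cell, statement-typer seat abc-iut-L4-t3 (wave 1).
-/
import Literature.AnabelianGeometry.AbsoluteAnabelian.LogFrobeniusIncompatibility
import Literature.AnabelianGeometry.AbsoluteAnabelian.LogFrobeniusTelecoreProofs
import HarnessLib

/-!
# [AbsTopIII] Corollary 5.5 (iii), last sentence: the observables are compatible with the telecore `𝔗_{An•}`

S. Mochizuki, *Topics in absolute anabelian geometry III: global reconstruction algorithms*,
J. Math. Sci. Univ. Tokyo 22 (2015) 939–1156 [MochizukiAbsTopIII2015]; locator read on the page: Cor 5.5 (iii) p. 131,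
last sentence: "Moreover, the families of homotopies that constitute `S_log` and `S_log⊞` are compatible with one another
as well as with the families of homotopies that constitute the core and telecore structures of (i), (ii)" (proof p. 132:
"the compatibility of the resulting family of homotopies with the families of homotopies that constitute the core and
telecore structures of (i), (ii) is immediate from the definitions").

`LogFrobeniusObservables.lean` (this seat) typed this sentence for the CORES of (i) inside the ambient diagram `D•⊢`
(`Cor55ObservablesCompatible`: one family on `D•⊢` realising the cores and containing `S_log⊞_v`, `S_log_v` for all `v`),
leaving the TELECORE clause TODO(general form): the telecore family `𝔍` of `𝔗_{An•}` lives on the telecore diagram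
`D_{An•}` (`D•_{≤6}` with the telecore edges `φ_⋏` appended, Cor 5.5 (ii)), not on `D•⊢`. Over
`LogFrobeniusIncompatibility.lean` (the graph embeddings `embPlus` / `embTS` of the observables' diagrams
`D•_{≤2} ∪ {𝒩⊞_v}`, `(D•_{≤3})_v ∪ {𝒩_v}` into `Γ⃗_{D_{An•}}`, and `SubFamily`, `CompatibleInTelecorePlus/TS`), this file
types the telecore clause inside `D_{An•}` (`Cor55ObservablesTelecoreCompatible`): there exist a core structure of (i)
(`n = 6`, core vertex `An•[𝒳]`) with a telecore of the printed shape over it (edges `φ_⋏ = φ_{An•}`), the core structure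
of (i) for `n = 5` (core vertex `ℰ•`, embedded by `embE5`), observable structures `S_log⊞_v`, `S_log_v` at every `v`, and
ONE family of homotopies `K` on `D_{An•}` containing `𝔍` — hence (Def 3.5 (iv) (b), `𝔍|_𝒮 = ℋ`) the core family of
`An•[𝒳]` — and the embedded families of the `ℰ•`-core and of all the observables. NOT included, deliberately: the contact
structure `ℋ_{An•}` — WITH it, the second sentence of Cor 5.5 (iv) asserts INcompatibility
(`Cor55NotSimultaneouslyCompatible`); and the third core of (i) (`n = 7`, the `ℰ•` of row 7 over `D•_{≤6}`), whose
diagram `D•_{≤7}` is not contained in `D_{An•}` (that compatibility is the one recorded in `D•⊢` by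
`Cor55ObservablesCompatible`). `cor55ObservablesTS_of_telecoreCompatible` / `cor55Telecore_of_telecoreCompatible` record
that the statement refines (iii)'s existence clause and (ii). An ASSUMPTION on `(L, TS)` asserted by the text for the
genuine theaters; refereed pre-IUT material; nothing here bears on [IUTchIII] Cor. 3.12; typed ≠ discharged.
-/

set_option autoImplicit false

universe u

open CategoryTheory Quiver

namespace Literature.AnabelianGeometry.AbsoluteAnabelian

namespace LogFrobeniusSetting

variable {Vmod : Type u} {isArc : Vmod → Bool} (L : LogFrobeniusSetting Vmod isArc)

/-- `D•_{≤4} ⊆ D•_{≤5}`. [cite: MochizukiAbsTopIII2015, Cor 5.5 p. 130] -/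
theorem inFive_of_inFour {x : DVertex Vmod isArc} (h : x.InFirstRows 4) : InFive (isArc := isArc) x :=
  ⟨h.1, h.2.trans (by decide)⟩

section Embedding

variable (J : DSub (InFive (isArc := isArc)) → Type u)

/-- the inclusion of oriented graphs `Γ⃗_{D•_{≤4} ∪ {ℰ•}} ↪ Γ⃗_{D_{An•}}` (the core vertex `ℰ•` of the core of (i) for `n = 5` is
the row-5 vertex of `D•_{≤5} ⊆ D_{An•}`). [cite: MochizukiAbsTopIII2015, Cor 5.5 (iii) p. 131] -/
def embE5 : (obsShape (DVertex.InFirstRows (isArc := isArc) 4) DVertex.e5).Vertex ⥤q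
    (anTelecoreShape (isArc := isArc) J).Vertex where
  obj a := match a with
    | ExtVertex.base a => ExtVertex.base ⟨a.1, inFive_of_inFour a.2⟩
    | ExtVertex.obs => ExtVertex.base ⟨.e5, e5_mem_five⟩
  map {a b} e := match a, b, e with
    | ExtVertex.base _, ExtVertex.base _, e => e
    | ExtVertex.base _, ExtVertex.obs, i => i
    | ExtVertex.obs, ExtVertex.base _, j => PEmpty.elim j
    | ExtVertex.obs, ExtVertex.obs, e => PEmpty.elim e

end Embedding

/-- the family of homotopies of a core structure of `D•_{≤5}` on `D•_{≤4}` (core vertex `ℰ•`, Cor 5.5 (i), `n = 5`) EMBEDS into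
a family `K` on `D_{An•}`. [cite: MochizukiAbsTopIII2015, Cor 5.5 (iii) p. 131] -/
def CompatibleInTelecoreE5 (J : DSub (InFive (isArc := isArc)) → Type u)
    (tel : ∀ {a : DSub (InFive (isArc := isArc))}, J a → (L.An ⥤ a.1.category L))
    (K : (L.anTelecoreDiagram J tel).HomotopyFamily)
    (H : ((L.subdiagram (DVertex.InFirstRows 4)).extend (L.obsExt (DVertex.InFirstRows 4) .e5)).HomotopyFamily) : Prop :=
  ∀ ⦃a b : (obsShape (DVertex.InFirstRows (isArc := isArc) 4) DVertex.e5).Vertex⦄ (p q : Path a b) (h : H.E p q),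
    ∃ h' : K.E ((embE5 J).mapPath p) ((embE5 J).mapPath q), HEq (H.η h) (K.η h')

/-- **Cor 5.5 (iii), last sentence — the TELECORE clause** (assumption on `(L, TS)`): "the families of homotopies that
constitute `S_log` and `S_log⊞` are compatible with one another as well as with the families of homotopies that constitute
the core and telecore structures of (i), (ii)", inside the telecore diagram `D_{An•}`: there exist a core structure of (i)
with core vertex `An•[𝒳]` (`n = 6`) and a telecore `𝔗_{An•}` of the printed shape over it (telecore edges
`φ_⋏ : An•[𝒳] → 𝒳_⋏`, `⋏ ∈ L ∪ {□}`, carrying `φ_{An•}`), a core structure of (i) with core vertex `ℰ•` (`n = 5`), observable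
structures `S_log⊞_v` (`IsLogObservablePlus`) and `S_log_v` (`IsLogObservableTS`) at every `v ∈ V(F_mod)`, and ONE family
of homotopies `K` on `D_{An•}` (Def 3.5 (ii) "compatible") that contains the telecore family `𝔍` (hence, by `𝔍|_𝒮 = ℋ`,
the core family of `An•[𝒳]`), the embedded core family of `ℰ•`, and the embedded families of all the `S_log⊞_v`, `S_log_v`.
The contact structure `ℋ_{An•}` is NOT among the compatible families (Cor 5.5 (iv), second sentence:
`Cor55NotSimultaneouslyCompatible`); the `n = 7` core lives outside `D_{An•}` (see `Cor55ObservablesCompatible`).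
Degenerate boundary (disclosure): for `V(F_mod) = ∅` the statement is FALSE as typed — no core structure with core vertex
`An•[𝒳]` exists on `D•_{≤5}` (`□` does not reach it: abc-iut-L4-t15's `not_cor55Telecore_of_isEmpty`), exactly as for
`Cor55Telecore` (`cor55Telecore_iff_nonempty`); it is an assumption on the genuine theaters, where `V(F_mod) ≠ ∅`
(`not_cor55ObservablesTelecoreCompatible_of_isEmpty` below). [cite: MochizukiAbsTopIII2015, Cor 5.5 (iii) p. 131] -/
def Cor55ObservablesTelecoreCompatible (TS : L.TSHomotopies) : Prop :=
  ∃ (H : ((L.subdiagram (InFive (isArc := isArc))).extend (L.obsExt InFive .an)).HomotopyFamily)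
    (hH : ∀ ⦃a b : (obsShape (InFive (isArc := isArc)) DVertex.an).Vertex⦄ ⦃p q : Path a b⦄,
      H.E p q → b = (obsShape (InFive (isArc := isArc)) DVertex.an).obs)
    (hc : (DiagramOfCategories.Observable.mk _ (fun _ => (inferInstance : IsEmpty PEmpty.{u + 1})) _ H hH).IsCore)
    (T : DiagramOfCategories.Telecore _ _ hc)
    (_ : T.J = (fun a => TelecoreIdx a.1))
    (_ : HEq (fun (a : DSub (InFive (isArc := isArc))) (j : T.J a) => T.telMap j)
      (fun (a : DSub (InFive (isArc := isArc))) (j : TelecoreIdx a.1) => L.telecoreFun a.1 j))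
    (H5 : ((L.subdiagram (DVertex.InFirstRows 4)).extend (L.obsExt (DVertex.InFirstRows 4) .e5)).HomotopyFamily)
    (hH5 : ∀ ⦃a b : (obsShape (DVertex.InFirstRows (isArc := isArc) 4) DVertex.e5).Vertex⦄ ⦃p q : Path a b⦄,
      H5.E p q → b = (obsShape (DVertex.InFirstRows (isArc := isArc) 4) DVertex.e5).obs)
    (Hplus : ∀ v : Vmod, (L.logDiagramPlus v).HomotopyFamily) (Hts : ∀ v : Vmod, (L.logDiagramTS v).HomotopyFamily)
    (K : (L.anTelecoreDiagram T.J T.telMap).HomotopyFamily),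
    (DiagramOfCategories.Observable.mk _ (fun _ => (inferInstance : IsEmpty PEmpty.{u + 1})) _ H5 hH5).IsCore ∧
      (∀ v : Vmod, L.IsLogObservablePlus v (Hplus v) ∧ L.IsLogObservableTS TS v (Hts v)) ∧
      SubFamily T.Jfam K ∧ L.CompatibleInTelecoreE5 T.J T.telMap K H5 ∧
      ∀ v : Vmod, L.CompatibleInTelecorePlus T.J T.telMap K v (Hplus v) ∧ L.CompatibleInTelecoreTS T.J T.telMap K v (Hts v)

/-- the telecore-compatibility clause refines the existence clause of Cor 5.5 (iii) for the `TS`-valued observables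
(`Cor55ObservablesTS`). [cite: MochizukiAbsTopIII2015, Cor 5.5 (iii) p. 131] -/
theorem cor55ObservablesTS_of_telecoreCompatible (TS : L.TSHomotopies) (h : L.Cor55ObservablesTelecoreCompatible TS) :
    L.Cor55ObservablesTS TS := by
  obtain ⟨_, _, _, _, _, _, _, _, _, Hts, _, _, hobs, _⟩ := h
  exact fun v => ⟨Hts v, (hobs v).2⟩

/-- the telecore-compatibility clause refines Cor 5.5 (i) for `n = 5` (a core structure on `D•_{≤4}` with core vertex `ℰ•`,
`IsCoreOn`). [cite: MochizukiAbsTopIII2015, Cor 5.5 (i) p. 130] -/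
theorem isCoreOn_e5_of_telecoreCompatible (TS : L.TSHomotopies) (h : L.Cor55ObservablesTelecoreCompatible TS) :
    L.IsCoreOn (DVertex.InFirstRows 4) .e5 := by
  obtain ⟨_, _, _, _, _, _, H5, hH5, _, _, _, h5, _⟩ := h
  exact ⟨H5, hH5, h5⟩

/-- the telecore-compatibility clause refines Cor 5.5 (i) for `n = 6` (a core structure on `D•_{≤5}` with core vertex
`An•[𝒳]`). [cite: MochizukiAbsTopIII2015, Cor 5.5 (i) p. 130] -/
theorem isCoreOn_an_of_telecoreCompatible (TS : L.TSHomotopies) (h : L.Cor55ObservablesTelecoreCompatible TS) :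
    L.IsCoreOn InFive .an := by
  obtain ⟨H, hH, hc, _⟩ := h
  exact ⟨H, hH, hc⟩

/-- **`V(F_mod) ≠ ∅` is necessary** for the telecore-compatibility clause as typed: its core clause for `An•[𝒳]` already
fails when `V(F_mod) = ∅` (abc-iut-L4-t15's `not_cor55Telecore_of_isEmpty`, through the unpinned Cor 5.5 (ii)).
[cite: MochizukiAbsTopIII2015, Cor 5.5 (iii) p. 131] -/
theorem not_cor55ObservablesTelecoreCompatible_of_isEmpty [IsEmpty Vmod] (TS : L.TSHomotopies) :
    ¬ L.Cor55ObservablesTelecoreCompatible TS := by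
  rintro ⟨H, hH, hc, T, hJ, htel, _⟩
  refine L.not_cor55Telecore_of_isEmpty ⟨H, hH, hc, T, hJ, htel, T.Jfam, ⟨T.Jfam, fun i => ?_⟩⟩
  cases i <;> exact ⟨fun _ _ _ _ h => h, fun _ _ _ _ _ => rfl⟩

end LogFrobeniusSetting

end Literature.AnabelianGeometry.AbsoluteAnabelian
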